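import Summits.AtomisticToContinuum.BoseEinsteinCondensation.Theorems.ParticleTensorisation.Negative.PosdefDressingWells

/-!
# Crux `ParticleTensorisation` (stmt-AtomisticToContinuum-14367) — `Negative/`:
# Dobrushin's condition for the Curie–Weiss-on-wells reference and its weighted Poincaré
# inequality (file W2)

Toward `¬ stub_posdefDressing`: the one-site conditional law of the reference weight
`w = ∏χ · e^{b(M²-N²)/2}` (file W1) at site `j` is "spin `+` with probability
`g(M_j) = v⁺/(v⁺ + v⁻ e^{-2bM_j})`, then uniform in the chosen well" (`v^± = u(W^±_j) > 0`), so
moving another particle (`|ΔM_j| ≤ 2`) moves it by at most `(b/2)·2 = b` on test functions of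
oscillation `1` (`g` is `b/2`-Lipschitz: its derivative is `2b v⁺v⁻e^{-2bm}/(v⁺+v⁻e^{-2bm})² ≤ b/2`).
With `b = β₁/N` the Dobrushin row sum is `(N-1)b < β₁ < 1`, and the tree's abstract theorem
`JastrowDobrushin.integral_sub_mean_sq_mul_w_le` yields the weighted approximate tensorisation
`∫ (F - c₀)² w ≤ (1 - (N-1)b)⁻¹ ∑_j ∫ (F - g_j)² w` for the normalised box product measure.
Rung style (defining hypotheses, no definitions).
-/

noncomputable section

namespace Summit.AtomisticToContinuum.BoseEinsteinCondensation.Theorems.PosdefDressingNeg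

open MeasureTheory Function Finset Set JastrowDobrushin
open scoped ENNReal
open Literature.MathematicalPhysics.QuantumManyBody.BoseGas

/-! ### The `b/2`-Lipschitz mixing weight -/

/-- The two-well mixing weight `g(m) = v⁺/(v⁺ + v⁻ e^{-2bm})` is `b/2`-Lipschitz (`v^± > 0`,
`b ≥ 0`): its derivative `2b v⁺ v⁻ e^{-2bm} / (v⁺ + v⁻ e^{-2bm})²` is at most `b/2` by AM–GM.
[folklore] -/
theorem abs_mixing_sub_le {vp vq b : ℝ} (hvp : 0 < vp) (hvq : 0 < vq) (hb : 0 ≤ b) (m m' : ℝ) :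
    |vp / (vp + vq * Real.exp (-2 * b * m)) - vp / (vp + vq * Real.exp (-2 * b * m'))| ≤
      b / 2 * |m - m'| := by
  set g : ℝ → ℝ := fun m => vp / (vp + vq * Real.exp (-2 * b * m)) with hg
  have hden : ∀ m, 0 < vp + vq * Real.exp (-2 * b * m) := fun m => by positivity
  have hderiv : ∀ m, HasDerivAt g
      (2 * b * vp * vq * Real.exp (-2 * b * m) / (vp + vq * Real.exp (-2 * b * m)) ^ 2) m := by
    intro m
    have h1 : HasDerivAt (fun m => vp + vq * Real.exp (-2 * b * m))
        (vq * (Real.exp (-2 * b * m) * (-2 * b))) m := by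
      have h0 : HasDerivAt (fun m => -2 * b * m) (-2 * b) m := by
        simpa using (hasDerivAt_id m).const_mul (-2 * b)
      exact (h0.exp.const_mul vq).const_add vp
    have h2 := (h1.inv (hden m).ne').const_mul vp
    have hfun : g = fun y => vp * ((fun m => vp + vq * Real.exp (-2 * b * m)) y)⁻¹ := by
      funext y; simp only [hg, div_eq_mul_inv]
    rw [hfun]
    refine h2.congr_deriv ?_
    field_simp
  have hdiff : Differentiable ℝ g := fun m => (hderiv m).differentiableAt
  have hd : ∀ m, deriv g m =
      2 * b * vp * vq * Real.exp (-2 * b * m) / (vp + vq * Real.exp (-2 * b * m)) ^ 2 :=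
    fun m => (hderiv m).deriv
  have hup : ∀ m, deriv g m ≤ b / 2 := by
    intro m
    rw [hd, div_le_iff₀ (pow_pos (hden m) 2)]
    have hsq := sq_nonneg (vp - vq * Real.exp (-2 * b * m))
    have he := Real.exp_pos (-2 * b * m)
    nlinarith [mul_nonneg hb hsq]
  have hlow : ∀ m, 0 ≤ deriv g m := fun m => by rw [hd]; positivity
  rcases le_total m m' with hle | hle
  · have h1 := image_sub_le_mul_sub_of_deriv_le hdiff hup hle
    have h2 := mul_sub_le_image_sub_of_le_deriv hdiff hlow hle
    rw [abs_sub_comm, abs_of_nonneg (by linarith), abs_of_nonpos (by linarith)]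
    linarith
  · have h1 := image_sub_le_mul_sub_of_deriv_le hdiff hup hle
    have h2 := mul_sub_le_image_sub_of_le_deriv hdiff hlow hle
    rw [abs_of_nonneg (by linarith), abs_of_nonneg (by linarith)]
    linarith

/-- The two-well conditional mean `(P + e^{-2bm} Q)/(v⁺ + e^{-2bm} v⁻)` is the mixture
`B + g(m)(A - B)` of the well averages `A = P/v⁺`, `B = Q/v⁻`. [folklore] -/
theorem twoWell_ratio_eq {vp vq b m P Q : ℝ} (hvp : 0 < vp) (hvq : 0 < vq) :
    (P + Real.exp (-2 * b * m) * Q) / (vp + Real.exp (-2 * b * m) * vq) =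
      Q / vq + vp / (vp + vq * Real.exp (-2 * b * m)) * (P / vp - Q / vq) := by
  have he := Real.exp_pos (-2 * b * m)
  have hden : 0 < vp + Real.exp (-2 * b * m) * vq := by positivity
  field_simp
  ring

/-! ### One-site integrals of the Curie–Weiss-on-wells weight -/

section Model

variable {N : ℕ} {a b : ℝ}
variable {qp qm : Fin N → Fin 3 → ℝ} {Wp Wm : Fin N → Set Space} {s : Space → ℝ}
  {χ : Fin N → Space → ℝ} {M : (Fin N → Space) → ℝ} {Mj : Fin N → (Fin N → Space) → ℝ}
  {w : (Fin N → Space) → ℝ} {π B : Fin N → (Fin N → Space) → ℝ}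
variable {uL : Measure Space} {S' T' : Fin N → ((Fin N → Space) → ℝ) → (Fin N → Space) → ℝ}

/-- **Two-well splitting of a one-site integral.** For bounded measurable `φ`,
`∫ φ(z) χ_j(z) e^{b(s(z)m - (N-1))} du(z) = e^{b(m-(N-1))} ∫_{W⁺_j} φ du + e^{b(-m-(N-1))} ∫_{W⁻_j} φ du`.
[folklore] -/
theorem integral_twoWell [IsFiniteMeasure uL] (hs : ∀ x, s x = if x 0 < 5 / 4 then 1 else -1)
    (hqp : ∀ k, qp k = ![1, 1 + (k : ℝ) / N, 1]) (hqm : ∀ k, qm k = ![3 / 2, 1 + (k : ℝ) / N, 1])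
    (hWp : ∀ k, Wp k = {x : Space | ∀ i, x i ∈ Ioo (qp k i) (qp k i + a)})
    (hWm : ∀ k, Wm k = {x : Space | ∀ i, x i ∈ Ioo (qm k i) (qm k i + a)}) (ha : a ≤ 1 / 4)
    (hχ : ∀ k x, χ k x = (Wp k ∪ Wm k).indicator (fun _ => (1 : ℝ)) x) (j : Fin N) (m : ℝ)
    {φ : Space → ℝ} (hφm : Measurable φ) {Cφ : ℝ} (hφb : ∀ z, |φ z| ≤ Cφ) :
    ∫ z, φ z * (χ j z * Real.exp (b * (s z * m - ((N : ℝ) - 1)))) ∂uL =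
      Real.exp (b * (m - ((N : ℝ) - 1))) * ∫ z in Wp j, φ z ∂uL +
        Real.exp (b * (-m - ((N : ℝ) - 1))) * ∫ z in Wm j, φ z ∂uL := by
  have hWpm : MeasurableSet (Wp j) := by rw [hWp]; exact measurableSet_cell _ _
  have hWmm : MeasurableSet (Wm j) := by rw [hWm]; exact measurableSet_cell _ _
  have hdisj := disjoint_Wp_Wm hqp hqm hWp hWm ha j j
  have hpt : ∀ z, φ z * (χ j z * Real.exp (b * (s z * m - ((N : ℝ) - 1)))) =
      (Wp j).indicator (fun z => Real.exp (b * (m - ((N : ℝ) - 1))) * φ z) z +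
        (Wm j).indicator (fun z => Real.exp (b * (-m - ((N : ℝ) - 1))) * φ z) z := by
    intro z
    by_cases hp : z ∈ Wp j
    · have hnm : z ∉ Wm j := Set.disjoint_left.mp hdisj hp
      rw [hχ, Set.indicator_of_mem (Set.mem_union_left _ hp), Set.indicator_of_mem hp,
        Set.indicator_of_notMem hnm, s_of_mem_Wp hs hqp hWp ha hp]
      ring_nf
    · by_cases hm' : z ∈ Wm j
      · rw [hχ, Set.indicator_of_mem (Set.mem_union_right _ hm'), Set.indicator_of_notMem hp,
          Set.indicator_of_mem hm', s_of_mem_Wm hs hqm hWm hm']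
        ring_nf
      · have hn : z ∉ Wp j ∪ Wm j := fun h => h.elim hp hm'
        rw [hχ, Set.indicator_of_notMem hn, Set.indicator_of_notMem hp,
          Set.indicator_of_notMem hm']
        ring
  simp_rw [hpt]
  have hi : ∀ (c : ℝ) (S : Set Space), MeasurableSet S →
      Integrable (S.indicator fun z => c * φ z) uL := fun c S hS =>
    (integrable_of_bounded (hφm.const_mul c) (C := |c| * Cφ) fun z => by
      rw [abs_mul]; exact mul_le_mul_of_nonneg_left (hφb z) (abs_nonneg c)).indicator hS
  rw [integral_add (hi _ _ hWpm) (hi _ _ hWmm), integral_indicator hWpm, integral_indicator hWmm,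
    integral_const_mul, integral_const_mul]

/-- The normalised box measure of a well is positive: `u(W^±_j) = a³/27 > 0`. [folklore] -/
theorem measureReal_cell_pos (huL : uL = (ENNReal.ofReal ((3 : ℝ) ^ 3))⁻¹ • volume.restrict (box 3))
    (q : Fin 3 → ℝ) (hq : ∀ i, 0 < q i) (hqa : ∀ i, q i + a ≤ 3) (ha0 : 0 < a) :
    0 < uL.real {x : Space | ∀ i, x i ∈ Ioo (q i) (q i + a)} := by
  rw [measureReal_def, huL, Measure.smul_apply, Measure.restrict_apply (measurableSet_cell q a),
    Set.inter_eq_left.mpr (cell_subset_box q hq hqa), volume_cell q a, smul_eq_mul,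
    ENNReal.toReal_mul, ENNReal.toReal_inv, ENNReal.toReal_ofReal (by norm_num),
    ENNReal.toReal_pow, ENNReal.toReal_ofReal ha0.le]
  positivity

/-- **Dobrushin's condition** for the Curie–Weiss-on-wells reference: the heat-bath mean of a
test function of `x_j` with oscillation `δ` moves by at most `b δ` when another particle `k ≠ j`
is moved. [folklore] -/
theorem cw_hD (hb : 0 ≤ b) (hs : ∀ x, s x = if x 0 < 5 / 4 then 1 else -1)
    (hqp : ∀ k, qp k = ![1, 1 + (k : ℝ) / N, 1]) (hqm : ∀ k, qm k = ![3 / 2, 1 + (k : ℝ) / N, 1])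
    (hWp : ∀ k, Wp k = {x : Space | ∀ i, x i ∈ Ioo (qp k i) (qp k i + a)})
    (hWm : ∀ k, Wm k = {x : Space | ∀ i, x i ∈ Ioo (qm k i) (qm k i + a)})
    (ha0 : 0 < a) (ha : a ≤ 1 / 4)
    (hχ : ∀ k x, χ k x = (Wp k ∪ Wm k).indicator (fun _ => (1 : ℝ)) x)
    (hMj : ∀ j X, Mj j X = ∑ k ∈ univ.erase j, s (X k))
    (hπ : ∀ j X, π j X = χ j (X j) * Real.exp (b * (s (X j) * Mj j X - ((N : ℝ) - 1))))
    (huL : uL = (ENNReal.ofReal ((3 : ℝ) ^ 3))⁻¹ • volume.restrict (box 3))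
    (hS' : ∀ j G X, S' j G X = ∫ y, G (update X j y) ∂uL)
    (hT' : ∀ j F X, T' j F X = S' j (fun Y => F Y * π j Y) X / S' j (π j) X) :
    ∀ j k, j ≠ k → ∀ (X : Fin N → Space) (y y' : Space) (φ : Space → ℝ) (Cφ δ : ℝ),
      Measurable φ → (∀ z, |φ z| ≤ Cφ) → (∀ z z', |φ z - φ z'| ≤ δ) →
      |T' j (fun Y => φ (Y j)) (update X k y) - T' j (fun Y => φ (Y j)) (update X k y')| ≤
        b * δ := by
  intro j k hjk X y y' φ Cφ δ hφm hφb hφδ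
  haveI : IsProbabilityMeasure uL := huL ▸ isProbabilityMeasure_boxMeasure (by norm_num)
  have hWpm : MeasurableSet (Wp j) := by rw [hWp]; exact measurableSet_cell _ _
  have hWmm : MeasurableSet (Wm j) := by rw [hWm]; exact measurableSet_cell _ _
  -- volumes of the two wells
  set vp : ℝ := uL.real (Wp j) with hvp
  set vq : ℝ := uL.real (Wm j) with hvq
  have hk3 : ((j : ℕ) : ℝ) / N < 1 := by
    rcases Nat.eq_zero_or_pos N with hN | hN
    · exact absurd j.isLt (by omega)
    · rw [div_lt_one (by exact_mod_cast hN)]; exact_mod_cast j.isLt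
  have hk0 : 0 ≤ ((j : ℕ) : ℝ) / N := by positivity
  have hvp0 : 0 < vp := by
    rw [hvp, hWp]
    refine measureReal_cell_pos huL (qp j) (fun i => ?_) (fun i => ?_) ha0 <;>
      fin_cases i <;> simp [hqp] <;> linarith
  have hvq0 : 0 < vq := by
    rw [hvq, hWm]
    refine measureReal_cell_pos huL (qm j) (fun i => ?_) (fun i => ?_) ha0 <;>
      fin_cases i <;> simp [hqm] <;> linarith
  -- the two test integrals
  set P : ℝ := ∫ z in Wp j, φ z ∂uL with hP
  set Q : ℝ := ∫ z in Wm j, φ z ∂uL with hQ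
  -- the heat-bath mean as a two-well ratio
  have key : ∀ y, T' j (fun Y => φ (Y j)) (update X k y) =
      (P + Real.exp (-2 * b * Mj j (update X k y)) * Q) /
        (vp + Real.exp (-2 * b * Mj j (update X k y)) * vq) := by
    intro y
    set m : ℝ := Mj j (update X k y) with hm
    rw [hT', hS', hS']
    simp only [update_self]
    have hπz : ∀ z, π j (update (update X k y) j z) =
        χ j z * Real.exp (b * (s z * m - ((N : ℝ) - 1))) := fun z => by
      rw [hπ, update_self, Mj_update_self hMj]
    simp_rw [hπz]
    rw [integral_twoWell hs hqp hqm hWp hWm ha hχ j m hφm hφb]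
    have h1 := integral_twoWell (uL := uL) (b := b) hs hqp hqm hWp hWm ha hχ j m measurable_const
      (Cφ := 1) (φ := fun _ => (1 : ℝ)) (fun z => by simp)
    simp only [one_mul] at h1
    rw [h1, setIntegral_const, setIntegral_const, smul_eq_mul, mul_one, smul_eq_mul, mul_one,
      ← hvp, ← hvq, ← hP, ← hQ]
    have he : Real.exp (b * (-m - ((N : ℝ) - 1))) =
        Real.exp (b * (m - ((N : ℝ) - 1))) * Real.exp (-2 * b * m) := by
      rw [← Real.exp_add]; congr 1; ring
    have hd1 : Real.exp (b * (m - ((N : ℝ) - 1))) * vp + Real.exp (b * (-m - ((N : ℝ) - 1))) * vq ≠ 0 :=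
      ne_of_gt (add_pos_of_pos_of_nonneg (mul_pos (Real.exp_pos _) hvp0)
        (mul_nonneg (Real.exp_pos _).le hvq0.le))
    have hd2 : vp + Real.exp (-2 * b * m) * vq ≠ 0 :=
      ne_of_gt (add_pos_of_pos_of_nonneg hvp0 (mul_nonneg (Real.exp_pos _).le hvq0.le))
    rw [div_eq_div_iff hd1 hd2, he]
    ring
  rw [key, key, twoWell_ratio_eq hvp0 hvq0, twoWell_ratio_eq hvp0 hvq0]
  -- oscillation of the well averages
  have hiφ : Integrable φ uL := integrable_of_bounded hφm hφb
  have hosc : |P / vp - Q / vq| ≤ δ := by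
    have bound : ∀ (S T : Set Space), MeasurableSet S → MeasurableSet T → 0 < uL.real S →
        0 < uL.real T →
        (∫ z in S, φ z ∂uL) / uL.real S - (∫ z in T, φ z ∂uL) / uL.real T ≤ δ := by
      intro S T hSm hTm hS0 hT0
      -- for `z' ∈ T`: `∫_S φ ≤ (φ z' + δ) u(S)`
      have h1 : ∀ z', (∫ z in S, φ z ∂uL) ≤ (φ z' + δ) * uL.real S := by
        intro z'
        have := setIntegral_mono_on (s := S) hiφ.integrableOn (integrableOn_const) hSm
          (g := fun _ => φ z' + δ) (fun z _ => by
            have := hφδ z z'; rw [abs_le] at this; linarith)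
        rwa [setIntegral_const, smul_eq_mul, mul_comm] at this
      -- integrate the resulting pointwise bound over `z' ∈ T`
      have h2 : ((∫ z in S, φ z ∂uL) / uL.real S - δ) * uL.real T ≤ ∫ z in T, φ z ∂uL := by
        have := setIntegral_mono_on (s := T) (integrableOn_const) hiφ.integrableOn hTm
          (f := fun _ => (∫ z in S, φ z ∂uL) / uL.real S - δ) (fun z' _ => by
            have := h1 z'
            rw [div_sub' (ne_of_gt hS0), div_le_iff₀ hS0]; linarith)
        rwa [setIntegral_const, smul_eq_mul, mul_comm] at this
      have h3 : ((∫ z in S, φ z ∂uL) / uL.real S - δ) ≤ (∫ z in T, φ z ∂uL) / uL.real T := by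
        rwa [le_div_iff₀ hT0]
      linarith
    rw [abs_le]
    constructor
    · have := bound (Wm j) (Wp j) hWmm hWpm hvq0 hvp0
      rw [← hP, ← hQ, ← hvp, ← hvq] at this
      linarith
    · have := bound (Wp j) (Wm j) hWpm hWmm hvp0 hvq0
      rw [← hP, ← hQ, ← hvp, ← hvq] at this
      exact this
  -- Lipschitz bound of the mixing weight and `|ΔM_j| ≤ 2`
  have hΔ : |Mj j (update X k y) - Mj j (update X k y')| ≤ 2 := by
    rw [Mj_update_of_ne hMj hjk, Mj_update_of_ne hMj hjk]
    have := abs_s_sub_s_le hs y y'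
    calc |Mj j X - s (X k) + s y - (Mj j X - s (X k) + s y')| = |s y - s y'| := by ring_nf
      _ ≤ 2 := this
  have hg := abs_mixing_sub_le hvp0 hvq0 hb (Mj j (update X k y)) (Mj j (update X k y'))
  have e1 : ∀ m : ℝ, vp + Real.exp (-2 * b * m) * vq = vp + vq * Real.exp (-2 * b * m) :=
    fun m => by ring
  calc |Q / vq + vp / (vp + vq * Real.exp (-2 * b * Mj j (update X k y))) * (P / vp - Q / vq) -
        (Q / vq + vp / (vp + vq * Real.exp (-2 * b * Mj j (update X k y'))) * (P / vp - Q / vq))|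
      = |vp / (vp + vq * Real.exp (-2 * b * Mj j (update X k y))) -
          vp / (vp + vq * Real.exp (-2 * b * Mj j (update X k y')))| * |P / vp - Q / vq| := by
        rw [← abs_mul]; congr 1; ring
    _ ≤ b / 2 * |Mj j (update X k y) - Mj j (update X k y')| * δ :=
        mul_le_mul hg hosc (abs_nonneg _) (by positivity)
    _ ≤ b / 2 * 2 * δ := by
        have hδ : 0 ≤ δ := (abs_nonneg _).trans (hφδ y y)
        gcongr
    _ = b * δ := by ring

/-- **One-site partition functions are positive**: `S_j π_j > 0` everywhere. [folklore] -/
theorem cw_hZ (hb : 0 ≤ b) (hs : ∀ x, s x = if x 0 < 5 / 4 then 1 else -1)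
    (hqp : ∀ k, qp k = ![1, 1 + (k : ℝ) / N, 1]) (hqm : ∀ k, qm k = ![3 / 2, 1 + (k : ℝ) / N, 1])
    (hWp : ∀ k, Wp k = {x : Space | ∀ i, x i ∈ Ioo (qp k i) (qp k i + a)})
    (hWm : ∀ k, Wm k = {x : Space | ∀ i, x i ∈ Ioo (qm k i) (qm k i + a)})
    (ha0 : 0 < a) (ha : a ≤ 1 / 4)
    (hχ : ∀ k x, χ k x = (Wp k ∪ Wm k).indicator (fun _ => (1 : ℝ)) x)
    (hMj : ∀ j X, Mj j X = ∑ k ∈ univ.erase j, s (X k))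
    (hπ : ∀ j X, π j X = χ j (X j) * Real.exp (b * (s (X j) * Mj j X - ((N : ℝ) - 1))))
    (huL : uL = (ENNReal.ofReal ((3 : ℝ) ^ 3))⁻¹ • volume.restrict (box 3))
    (hS' : ∀ j G X, S' j G X = ∫ y, G (update X j y) ∂uL) (j : Fin N) (X : Fin N → Space) :
    0 < S' j (π j) X := by
  haveI : IsProbabilityMeasure uL := huL ▸ isProbabilityMeasure_boxMeasure (by norm_num)
  have _ := hb
  have hk3 : ((j : ℕ) : ℝ) / N < 1 := by
    rcases Nat.eq_zero_or_pos N with hN | hN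
    · exact absurd j.isLt (by omega)
    · rw [div_lt_one (by exact_mod_cast hN)]; exact_mod_cast j.isLt
  have hk0 : 0 ≤ ((j : ℕ) : ℝ) / N := by positivity
  have hvp0 : 0 < uL.real (Wp j) := by
    rw [hWp]
    refine measureReal_cell_pos huL (qp j) (fun i => ?_) (fun i => ?_) ha0 <;>
      fin_cases i <;> simp [hqp] <;> linarith
  have hvq0 : 0 ≤ uL.real (Wm j) := measureReal_nonneg
  rw [hS']
  have hπz : ∀ z, π j (update X j z) =
      (1 : ℝ) * (χ j z * Real.exp (b * (s z * Mj j X - ((N : ℝ) - 1)))) := fun z => by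
    rw [hπ, update_self, Mj_update_self hMj, one_mul]
  simp_rw [hπz]
  rw [integral_twoWell hs hqp hqm hWp hWm ha hχ j (Mj j X) measurable_const (Cφ := 1)
    (fun z => by simp), setIntegral_const, setIntegral_const, smul_eq_mul, smul_eq_mul, mul_one,
    mul_one]
  have h1 : 0 < Real.exp (b * (Mj j X - ((N : ℝ) - 1))) * uL.real (Wp j) :=
    mul_pos (Real.exp_pos _) hvp0
  have h2 : 0 ≤ Real.exp (b * (-Mj j X - ((N : ℝ) - 1))) * uL.real (Wm j) :=
    mul_nonneg (Real.exp_pos _).le hvq0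
  linarith

/-- **Weighted approximate tensorisation for the Curie–Weiss-on-wells reference** (real-valued
form): if `(N-1)b < 1` then for bounded measurable `F` and bounded measurable predictors `g_j`
blind to `x_j`, `∫ (F - c₀)² w ≤ (1 - (N-1)b)⁻¹ ∑_j ∫ (F - g_j)² w` on `Λ₃^N` with the normalised
product measure (`c₀` the `w`-mean). From Dobrushin's condition (`cw_hD`) and the abstract
theorem `JastrowDobrushin.integral_sub_mean_sq_mul_w_le`. [folklore] -/
theorem cw_weighted_AT (hN : 0 < N) (hb : 0 ≤ b) (hr : ((N : ℝ) - 1) * b < 1)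
    (hs : ∀ x, s x = if x 0 < 5 / 4 then 1 else -1)
    (hqp : ∀ k, qp k = ![1, 1 + (k : ℝ) / N, 1]) (hqm : ∀ k, qm k = ![3 / 2, 1 + (k : ℝ) / N, 1])
    (hWp : ∀ k, Wp k = {x : Space | ∀ i, x i ∈ Ioo (qp k i) (qp k i + a)})
    (hWm : ∀ k, Wm k = {x : Space | ∀ i, x i ∈ Ioo (qm k i) (qm k i + a)})
    (ha0 : 0 < a) (ha : a ≤ 1 / 4)
    (hχ : ∀ k x, χ k x = (Wp k ∪ Wm k).indicator (fun _ => (1 : ℝ)) x)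
    (hM : ∀ X, M X = ∑ k, s (X k)) (hMj : ∀ j X, Mj j X = ∑ k ∈ univ.erase j, s (X k))
    (hw : ∀ X, w X = (∏ k, χ k (X k)) * Real.exp (b * ((M X) ^ 2 - (N : ℝ) ^ 2) / 2))
    (hπ : ∀ j X, π j X = χ j (X j) * Real.exp (b * (s (X j) * Mj j X - ((N : ℝ) - 1))))
    (hB : ∀ j X, B j X = (∏ k ∈ univ.erase j, χ k (X k)) *
      Real.exp (b * ((Mj j X) ^ 2 - ((N : ℝ) - 1) ^ 2) / 2))
    (huL : uL = (ENNReal.ofReal ((3 : ℝ) ^ 3))⁻¹ • volume.restrict (box 3))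
    (hS' : ∀ j G X, S' j G X = ∫ y, G (update X j y) ∂uL)
    (hT' : ∀ j F X, T' j F X = S' j (fun Y => F Y * π j Y) X / S' j (π j) X)
    {P' : ((Fin N → Space) → ℝ) → (Fin N → Space) → ℝ}
    (hP' : ∀ F X, P' F X = (Fintype.card (Fin N) : ℝ)⁻¹ * ∑ j, T' j F X)
    {F : (Fin N → Space) → ℝ} (hFm : Measurable F) {C : ℝ} (hFb : ∀ X, |F X| ≤ C)
    {g : Fin N → (Fin N → Space) → ℝ} (hgm : ∀ j, Measurable (g j)) {C' : ℝ}
    (hgb : ∀ j X, |g j X| ≤ C') (hg : ∀ j X y, g j (update X j y) = g j X) :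
    ∫ X, (F X - (∫ Y, F Y * w Y ∂(Measure.pi fun _ => uL)) /
        (∫ Y, w Y ∂(Measure.pi fun _ => uL))) ^ 2 * w X ∂(Measure.pi fun _ => uL) ≤
      (1 - ((N : ℝ) - 1) * b)⁻¹ * ∑ j, ∫ X, (F X - g j X) ^ 2 * w X ∂(Measure.pi fun _ => uL) := by
  haveI : IsProbabilityMeasure uL := huL ▸ isProbabilityMeasure_boxMeasure (by norm_num)
  haveI : Nonempty (Fin N) := ⟨⟨0, hN⟩⟩
  have hcard : (Fintype.card (Fin N) : ℝ) = N := by rw [Fintype.card_fin]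
  have key := integral_sub_mean_sq_mul_w_le (u := uL) (S := S') (T := T') (π := π) (w := w)
    (B := B) (P := P') hS' hT' (model_hπ' hb hs hWp hWm hχ hMj hπ)
    (cw_hZ hb hs hqp hqm hWp hWm ha0 ha hχ hMj hπ huL hS')
    (w_eq_B_mul_π hs hM hMj hw hπ hB) (model_hB' hb hs hWp hWm hχ hMj hB) hP' hb
    (cw_hD hb hs hqp hqm hWp hWm ha0 ha hχ hMj hπ huL hS' hT') (by rw [hcard]; exact hr)
    hFm hFb hgm hgb hg
  rw [hcard] at key
  exact key

end Model

end Summit.AtomisticToContinuum.BoseEinsteinCondensation.Theorems.PosdefDressingNeg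

end
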